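import Mathlib
import Summits.AtomisticToContinuum.Crystallization.Theses.PhononSlackCertificates
import Summits.AtomisticToContinuum.Crystallization.Theorems.PhononSlackCertificatesNearFarGlueRStableCore
import Summits.AtomisticToContinuum.Crystallization.Theorems.PhononSlackCertificatesNearFarGlueRLooseReduction
import Literature.MathematicalPhysics.StatisticalMechanics.LennardJonesClusters

/-!
# Crux `PhononSlackCertificates.NearFarGlueR` (stmt-AtomisticToContinuum-14970), line `Sketch`:
the STABLE-CORE normal form of the residual and of the target (registered sub-goal `stub_stableCoreReduction`)

Continuation lead c4, part 3f.  From stable-core exhaustion (`exists_stableCore`, part 3e):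

* `tightContact_ineq_of_stableCore`, `tightContactGap_iff_stableCore`: for every
  `θ ∈ [0, 0.711)`, `g > 0`, `g' > 0` the registered residual `stub_tightContactGap` is
  EQUIVALENT to its instance on STABLE CORES — `3/10`-separated, `θ`-well-bonded, `g`-hole-free,
  `g'`-move-stable configurations — and then holds with `min g₂ (min(0.711 − θ, g, g')/11664)`
  everywhere;
* `coercive_ineq_of_stableCore`, `coerciveTwoShellGap_iff_stableCore`: the same for the target;
* `nearFarGlueR_iff_stableCore`: the crux as typed says exactly that its antecedents yield the
  tight contact gap on configurations that are kink-bound (`θ = 0.71`), `0.01`-hole-free,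
  `0.02`-move-stable and `3/10`-separated; `coerciveTwoShellGap_iff_allBadGap_and_stableCore`.

So whoever proves the promoted crux may assume, for free: all distances `≥ 3/10`; every particle
bound at least like a kink atom; no vacancy-type site anywhere; and no particle — in particular no
displaced particle next to good crystal — can gain `0.02` by a single relocation.  What is left is
the COLLECTIVELY stable, well-bonded, hole-free interface (relaxed free surfaces, coherently
strained layers, grain boundaries, dislocation cores): the thin half of 3-D Lennard-Jones
crystallization.  (Part 3c `…NearFarGlueRCoreReduction` is the version without move-stability.)
All `[folklore]`.
-/


noncomputable section

namespace Summit.AtomisticToContinuum.Crystallization.Theorems.PhononSlackCertificatesNearFarGlueR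

open Literature.MathematicalPhysics.StatisticalMechanics
open Literature.Geometry.DiscreteGeometry
open Summit.AtomisticToContinuum.Crystallization.Theses.PhononSlackCertificates
open scoped BigOperators

/-! ## The residual and the target live on stable cores -/

/-- **The residual reduces to cores.**  If the tight contact gap `K·e* + g_c·#T(z) ≤ 𝓔(z)` holds
with ONE `g_c ≥ 0` for every core `z` (`3/10`-separated, `θ`-well-bonded, `g`-hole-free;
`0 ≤ θ < 0.711`, `g > 0`), then `N·e* + min g_c (min(0.711 − θ, g)/11664)·#T(x) ≤ 𝓔(x)` for EVERY
finite injective `x`. [folklore] -/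
theorem tightContact_ineq_of_stableCore {gc θ g g' : ℝ} (hgc : 0 ≤ gc) (hθ0 : 0 ≤ θ) (hθ : θ < 711 / 1000)
    (hg : 0 < g) (hg' : 0 < g')
    (H : ∀ (K : ℕ) (z : Fin K → EuclideanSpace ℝ (Fin 3)),
      (∀ i j : Fin K, i ≠ j → (3 / 10 : ℝ) ≤ dist (z i) (z j)) →
      (∀ j : Fin K, ∑ k ∈ Finset.univ.erase j,
        (min (lennardJones (dist (z j) (z k))) 0 +
          (1 / 2 : ℝ) * max (lennardJones (dist (z j) (z k))) 0) < -θ) →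
      (∀ p : EuclideanSpace ℝ (Fin 3), (∀ i : Fin K, (3 / 10 : ℝ) ≤ dist p (z i)) →
        -(98309653 / 125000000 : ℝ) - g < ∑ i, lennardJones (dist p (z i))) →
      (∀ (j : Fin K) (p : EuclideanSpace ℝ (Fin 3)), (∀ k : Fin K, k ≠ j → (3 / 10 : ℝ) ≤ dist p (z k)) →
        ∑ k ∈ Finset.univ.erase j, lennardJones (dist (z j) (z k)) - g' <
          ∑ k ∈ Finset.univ.erase j, lennardJones (dist p (z k))) →
      (K : ℝ) * (⨅ Q : PeriodicConfiguration 3, Q.energyPerParticle lennardJones) +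
          gc * (Nat.card {k : Fin K // ¬ IsTwoShellGood (1 / 20) (47 / 50) 1 z k ∧
            ∃ i : Fin K, IsTwoShellGood (1 / 20) (47 / 50) 1 z i ∧ dist (z i) (z k) ≤ 21 / 20} : ℝ) ≤
        interactionEnergy lennardJones z)
    {N : ℕ} (x : Fin N → EuclideanSpace ℝ (Fin 3)) (hx : Function.Injective x) :
    (N : ℝ) * (⨅ Q : PeriodicConfiguration 3, Q.energyPerParticle lennardJones) +
        min gc (min (min (711 / 1000 - θ) g) g' / 11664) *
          (Nat.card {j : Fin N // ¬ IsTwoShellGood (1 / 20) (47 / 50) 1 x j ∧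
            ∃ i : Fin N, IsTwoShellGood (1 / 20) (47 / 50) 1 x i ∧ dist (x i) (x j) ≤ 21 / 20} : ℝ) ≤
      interactionEnergy lennardJones x := by
  obtain ⟨K, z, u, hzsep, hzwb, hzhf, hzms, hEz, hTz, -⟩ := exists_stableCore hθ0 hθ hg hg' x hx
  have hH := H K z hzsep hzwb hzhf hzms
  set c : ℝ := min (min (711 / 1000 - θ) g) g' with hc
  have hc0 : 0 < c := lt_min (lt_min (by linarith) hg) hg'
  set m : ℝ := min gc (c / 11664) with hm
  have hm0 : 0 ≤ m := le_min hgc (by positivity)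
  have hmg : m ≤ gc := min_le_left _ _
  have hm2 : m * 11664 ≤ c := by
    have : m ≤ c / 11664 := min_le_right _ _
    rw [le_div_iff₀ (by norm_num : (0 : ℝ) < 11664)] at this
    linarith
  set tN : ℝ := (Nat.card {j : Fin N // ¬ IsTwoShellGood (1 / 20) (47 / 50) 1 x j ∧
      ∃ i : Fin N, IsTwoShellGood (1 / 20) (47 / 50) 1 x i ∧ dist (x i) (x j) ≤ 21 / 20} : ℝ) with htN
  set tK : ℝ := (Nat.card {k : Fin K // ¬ IsTwoShellGood (1 / 20) (47 / 50) 1 z k ∧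
      ∃ i : Fin K, IsTwoShellGood (1 / 20) (47 / 50) 1 z i ∧ dist (z i) (z k) ≤ 21 / 20} : ℝ) with htK
  have htK0 : 0 ≤ tK := Nat.cast_nonneg _
  have hu0 : (0 : ℝ) ≤ u := Nat.cast_nonneg _
  have h1 : m * tN ≤ m * tK + m * 11664 * u := by
    have := mul_le_mul_of_nonneg_left hTz hm0
    nlinarith [this]
  have h2 : m * tK ≤ gc * tK := mul_le_mul_of_nonneg_right hmg htK0
  have h3 : m * 11664 * u ≤ c * u := mul_le_mul_of_nonneg_right hm2 hu0
  have hH' : (K : ℝ) * (⨅ Q : PeriodicConfiguration 3, Q.energyPerParticle lennardJones) + gc * tK ≤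
      interactionEnergy lennardJones z := hH
  have hEz' : interactionEnergy lennardJones z -
      (K : ℝ) * (⨅ Q : PeriodicConfiguration 3, Q.energyPerParticle lennardJones) + c * u ≤
      interactionEnergy lennardJones x -
        (N : ℝ) * (⨅ Q : PeriodicConfiguration 3, Q.energyPerParticle lennardJones) := hEz
  linarith [hEz', hH', h1, h2, h3]

/-- **The registered residual is equivalent to its instance on CORES** (`0 ≤ θ < 0.711`, `g > 0`):
it suffices to prove the tight contact gap, with one `g₂ > 0`, for configurations that are
`3/10`-separated, `θ`-well-bonded (every particle bound at least kink-like for `θ ≈ 0.71`) and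
`g`-hole-free (no vacant site binding a test particle by more than `0.7865 + g`). [folklore] -/
theorem tightContactGap_iff_stableCore {θ g g' : ℝ} (hθ0 : 0 ≤ θ) (hθ : θ < 711 / 1000) (hg : 0 < g)
    (hg' : 0 < g') :
    (∀ δ : ℝ, 0 < δ → ∃ g₂ : ℝ, 0 < g₂ ∧ ∀ (N : ℕ) (x : Fin N → EuclideanSpace ℝ (Fin 3)),
      (∀ i j : Fin N, i ≠ j → δ ≤ dist (x i) (x j)) →
      (N : ℝ) * (⨅ Q : PeriodicConfiguration 3, Q.energyPerParticle lennardJones)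
        + g₂ * (Nat.card {j : Fin N // ¬ IsTwoShellGood (1 / 20) (47 / 50) 1 x j ∧
            ∃ i : Fin N, IsTwoShellGood (1 / 20) (47 / 50) 1 x i ∧ dist (x i) (x j) ≤ 21 / 20} : ℝ)
        ≤ interactionEnergy lennardJones x) ↔
    (∃ g₂ : ℝ, 0 < g₂ ∧ ∀ (K : ℕ) (z : Fin K → EuclideanSpace ℝ (Fin 3)),
      (∀ i j : Fin K, i ≠ j → (3 / 10 : ℝ) ≤ dist (z i) (z j)) →
      (∀ j : Fin K, ∑ k ∈ Finset.univ.erase j,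
        (min (lennardJones (dist (z j) (z k))) 0 +
          (1 / 2 : ℝ) * max (lennardJones (dist (z j) (z k))) 0) < -θ) →
      (∀ p : EuclideanSpace ℝ (Fin 3), (∀ i : Fin K, (3 / 10 : ℝ) ≤ dist p (z i)) →
        -(98309653 / 125000000 : ℝ) - g < ∑ i, lennardJones (dist p (z i))) →
      (∀ (j : Fin K) (p : EuclideanSpace ℝ (Fin 3)), (∀ k : Fin K, k ≠ j → (3 / 10 : ℝ) ≤ dist p (z k)) →
        ∑ k ∈ Finset.univ.erase j, lennardJones (dist (z j) (z k)) - g' <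
          ∑ k ∈ Finset.univ.erase j, lennardJones (dist p (z k))) →
      (K : ℝ) * (⨅ Q : PeriodicConfiguration 3, Q.energyPerParticle lennardJones)
        + g₂ * (Nat.card {k : Fin K // ¬ IsTwoShellGood (1 / 20) (47 / 50) 1 z k ∧
            ∃ i : Fin K, IsTwoShellGood (1 / 20) (47 / 50) 1 z i ∧ dist (z i) (z k) ≤ 21 / 20} : ℝ)
        ≤ interactionEnergy lennardJones z) := by
  constructor
  · intro h
    obtain ⟨g₂, hg₂, H⟩ := h (3 / 10) (by norm_num)
    exact ⟨g₂, hg₂, fun K z hzsep _ _ _ => H K z hzsep⟩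
  · rintro ⟨gc, hgc, H⟩ δ hδ
    refine ⟨min gc (min (min (711 / 1000 - θ) g) g' / 11664),
      lt_min hgc (div_pos (lt_min (lt_min (by linarith) hg) hg') (by norm_num)), fun N x hsep => ?_⟩
    exact tightContact_ineq_of_stableCore hgc.le hθ0 hθ hg hg' H x (fibre_injective_of_separated hδ hsep)

/-- **The target reduces to cores.**  If `K·e* + g_c·#bad(z) ≤ 𝓔(z)` with one `g_c ≥ 0` for every
core `z`, then `N·e* + min g_c (min(0.711 − θ, g)/2662)·#bad(x) ≤ 𝓔(x)` for every finite injective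
`x`. [folklore] -/
theorem coercive_ineq_of_stableCore {gc θ g g' : ℝ} (hgc : 0 ≤ gc) (hθ0 : 0 ≤ θ) (hθ : θ < 711 / 1000)
    (hg : 0 < g) (hg' : 0 < g')
    (H : ∀ (K : ℕ) (z : Fin K → EuclideanSpace ℝ (Fin 3)),
      (∀ i j : Fin K, i ≠ j → (3 / 10 : ℝ) ≤ dist (z i) (z j)) →
      (∀ j : Fin K, ∑ k ∈ Finset.univ.erase j,
        (min (lennardJones (dist (z j) (z k))) 0 +
          (1 / 2 : ℝ) * max (lennardJones (dist (z j) (z k))) 0) < -θ) →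
      (∀ p : EuclideanSpace ℝ (Fin 3), (∀ i : Fin K, (3 / 10 : ℝ) ≤ dist p (z i)) →
        -(98309653 / 125000000 : ℝ) - g < ∑ i, lennardJones (dist p (z i))) →
      (∀ (j : Fin K) (p : EuclideanSpace ℝ (Fin 3)), (∀ k : Fin K, k ≠ j → (3 / 10 : ℝ) ≤ dist p (z k)) →
        ∑ k ∈ Finset.univ.erase j, lennardJones (dist (z j) (z k)) - g' <
          ∑ k ∈ Finset.univ.erase j, lennardJones (dist p (z k))) →
      (K : ℝ) * (⨅ Q : PeriodicConfiguration 3, Q.energyPerParticle lennardJones) +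
          gc * (Nat.card {k : Fin K // ¬ IsTwoShellGood (1 / 20) (47 / 50) 1 z k} : ℝ) ≤
        interactionEnergy lennardJones z)
    {N : ℕ} (x : Fin N → EuclideanSpace ℝ (Fin 3)) (hx : Function.Injective x) :
    (N : ℝ) * (⨅ Q : PeriodicConfiguration 3, Q.energyPerParticle lennardJones) +
        min gc (min (min (711 / 1000 - θ) g) g' / 2662) *
          (Nat.card {i : Fin N // ¬ IsTwoShellGood (1 / 20) (47 / 50) 1 x i} : ℝ) ≤
      interactionEnergy lennardJones x := by
  obtain ⟨K, z, u, hzsep, hzwb, hzhf, hzms, hEz, -, hBz⟩ := exists_stableCore hθ0 hθ hg hg' x hx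
  have hH := H K z hzsep hzwb hzhf hzms
  set c : ℝ := min (min (711 / 1000 - θ) g) g' with hc
  have hc0 : 0 < c := lt_min (lt_min (by linarith) hg) hg'
  set m : ℝ := min gc (c / 2662) with hm
  have hm0 : 0 ≤ m := le_min hgc (by positivity)
  have hmg : m ≤ gc := min_le_left _ _
  have hm2 : m * 2662 ≤ c := by
    have : m ≤ c / 2662 := min_le_right _ _
    rw [le_div_iff₀ (by norm_num : (0 : ℝ) < 2662)] at this
    linarith
  set bN : ℝ := (Nat.card {i : Fin N // ¬ IsTwoShellGood (1 / 20) (47 / 50) 1 x i} : ℝ) with hbN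
  set bK : ℝ := (Nat.card {k : Fin K // ¬ IsTwoShellGood (1 / 20) (47 / 50) 1 z k} : ℝ) with hbK
  have hbK0 : 0 ≤ bK := Nat.cast_nonneg _
  have hu0 : (0 : ℝ) ≤ u := Nat.cast_nonneg _
  have h1 : m * bN ≤ m * bK + m * 2662 * u := by
    have := mul_le_mul_of_nonneg_left hBz hm0
    nlinarith [this]
  have h2 : m * bK ≤ gc * bK := mul_le_mul_of_nonneg_right hmg hbK0
  have h3 : m * 2662 * u ≤ c * u := mul_le_mul_of_nonneg_right hm2 hu0
  have hH' : (K : ℝ) * (⨅ Q : PeriodicConfiguration 3, Q.energyPerParticle lennardJones) + gc * bK ≤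
      interactionEnergy lennardJones z := hH
  have hEz' : interactionEnergy lennardJones z -
      (K : ℝ) * (⨅ Q : PeriodicConfiguration 3, Q.energyPerParticle lennardJones) + c * u ≤
      interactionEnergy lennardJones x -
        (N : ℝ) * (⨅ Q : PeriodicConfiguration 3, Q.energyPerParticle lennardJones) := hEz
  linarith [hEz', hH', h1, h2, h3]

/-- **The target is equivalent to its instance on cores** (`0 ≤ θ < 0.711`, `g > 0`). [folklore] -/
theorem coerciveTwoShellGap_iff_stableCore {θ g g' : ℝ} (hθ0 : 0 ≤ θ) (hθ : θ < 711 / 1000) (hg : 0 < g)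
    (hg' : 0 < g') :
    CoerciveTwoShellGap ↔
    (∃ g₀ : ℝ, 0 < g₀ ∧ ∀ (K : ℕ) (z : Fin K → EuclideanSpace ℝ (Fin 3)),
      (∀ i j : Fin K, i ≠ j → (3 / 10 : ℝ) ≤ dist (z i) (z j)) →
      (∀ j : Fin K, ∑ k ∈ Finset.univ.erase j,
        (min (lennardJones (dist (z j) (z k))) 0 +
          (1 / 2 : ℝ) * max (lennardJones (dist (z j) (z k))) 0) < -θ) →
      (∀ p : EuclideanSpace ℝ (Fin 3), (∀ i : Fin K, (3 / 10 : ℝ) ≤ dist p (z i)) →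
        -(98309653 / 125000000 : ℝ) - g < ∑ i, lennardJones (dist p (z i))) →
      (∀ (j : Fin K) (p : EuclideanSpace ℝ (Fin 3)), (∀ k : Fin K, k ≠ j → (3 / 10 : ℝ) ≤ dist p (z k)) →
        ∑ k ∈ Finset.univ.erase j, lennardJones (dist (z j) (z k)) - g' <
          ∑ k ∈ Finset.univ.erase j, lennardJones (dist p (z k))) →
      (K : ℝ) * (⨅ Q : PeriodicConfiguration 3, Q.energyPerParticle lennardJones) +
          g₀ * (Nat.card {k : Fin K // ¬ IsTwoShellGood (1 / 20) (47 / 50) 1 z k} : ℝ) ≤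
        interactionEnergy lennardJones z) := by
  constructor
  · intro h
    obtain ⟨g₀, hg₀, H⟩ := h (3 / 10) (by norm_num)
    exact ⟨g₀, hg₀, fun K z hzsep _ _ _ => H K z hzsep⟩
  · rintro ⟨gc, hgc, H⟩ δ hδ
    refine ⟨min gc (min (min (711 / 1000 - θ) g) g' / 2662),
      lt_min hgc (div_pos (lt_min (lt_min (by linarith) hg) hg') (by norm_num)), fun N x hsep => ?_⟩
    exact coercive_ineq_of_stableCore hgc.le hθ0 hθ hg hg' H x (fibre_injective_of_separated hδ hsep)

/-- **The crux as typed, on cores**: `NearFarGlueR` says exactly that its two antecedents yield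
the tight contact gap on KINK-BOUND (`θ = 71/100`), `1/100`-hole-free, `3/10`-separated
configurations (composition of the landed `nearFarGlueR_iff`, p107452, with
`tightContactGap_iff_stableCore`). [folklore] -/
theorem nearFarGlueR_iff_stableCore :
    NearFarGlueR ↔ (FarFieldGapR → NearFieldConvexity →
      ∃ g₂ : ℝ, 0 < g₂ ∧ ∀ (K : ℕ) (z : Fin K → EuclideanSpace ℝ (Fin 3)),
        (∀ i j : Fin K, i ≠ j → (3 / 10 : ℝ) ≤ dist (z i) (z j)) →
        (∀ j : Fin K, ∑ k ∈ Finset.univ.erase j,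
          (min (lennardJones (dist (z j) (z k))) 0 +
            (1 / 2 : ℝ) * max (lennardJones (dist (z j) (z k))) 0) < -(71 / 100 : ℝ)) →
        (∀ p : EuclideanSpace ℝ (Fin 3), (∀ i : Fin K, (3 / 10 : ℝ) ≤ dist p (z i)) →
          -(98309653 / 125000000 : ℝ) - 1 / 100 < ∑ i, lennardJones (dist p (z i))) →
        (∀ (j : Fin K) (p : EuclideanSpace ℝ (Fin 3)), (∀ k : Fin K, k ≠ j → (3 / 10 : ℝ) ≤ dist p (z k)) →
          ∑ k ∈ Finset.univ.erase j, lennardJones (dist (z j) (z k)) - 1 / 50 <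
            ∑ k ∈ Finset.univ.erase j, lennardJones (dist p (z k))) →
        (K : ℝ) * (⨅ Q : PeriodicConfiguration 3, Q.energyPerParticle lennardJones)
          + g₂ * (Nat.card {k : Fin K // ¬ IsTwoShellGood (1 / 20) (47 / 50) 1 z k ∧
              ∃ i : Fin K, IsTwoShellGood (1 / 20) (47 / 50) 1 z i ∧ dist (z i) (z k) ≤ 21 / 20} : ℝ)
          ≤ interactionEnergy lennardJones z) := by
  rw [nearFarGlueR_iff, tightContactGap_iff_stableCore (θ := 71 / 100) (g := 1 / 100) (g' := 1 / 50)
    (by norm_num) (by norm_num) (by norm_num) (by norm_num)]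

/-- **The target is exactly all-bad bulk gap ∧ the tight contact gap on cores** (kink-bound,
`1/100`-hole-free, `3/10`-separated; composition with the landed structure theorem
`coerciveTwoShellGap_iff_allBadGap_and_tightContactGap`, p125405). [folklore] -/
theorem coerciveTwoShellGap_iff_allBadGap_and_stableCore :
    CoerciveTwoShellGap ↔ AllBadGap ∧
      ∃ g₂ : ℝ, 0 < g₂ ∧ ∀ (K : ℕ) (z : Fin K → EuclideanSpace ℝ (Fin 3)),
        (∀ i j : Fin K, i ≠ j → (3 / 10 : ℝ) ≤ dist (z i) (z j)) →
        (∀ j : Fin K, ∑ k ∈ Finset.univ.erase j,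
          (min (lennardJones (dist (z j) (z k))) 0 +
            (1 / 2 : ℝ) * max (lennardJones (dist (z j) (z k))) 0) < -(71 / 100 : ℝ)) →
        (∀ p : EuclideanSpace ℝ (Fin 3), (∀ i : Fin K, (3 / 10 : ℝ) ≤ dist p (z i)) →
          -(98309653 / 125000000 : ℝ) - 1 / 100 < ∑ i, lennardJones (dist p (z i))) →
        (∀ (j : Fin K) (p : EuclideanSpace ℝ (Fin 3)), (∀ k : Fin K, k ≠ j → (3 / 10 : ℝ) ≤ dist p (z k)) →
          ∑ k ∈ Finset.univ.erase j, lennardJones (dist (z j) (z k)) - 1 / 50 <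
            ∑ k ∈ Finset.univ.erase j, lennardJones (dist p (z k))) →
        (K : ℝ) * (⨅ Q : PeriodicConfiguration 3, Q.energyPerParticle lennardJones)
          + g₂ * (Nat.card {k : Fin K // ¬ IsTwoShellGood (1 / 20) (47 / 50) 1 z k ∧
              ∃ i : Fin K, IsTwoShellGood (1 / 20) (47 / 50) 1 z i ∧ dist (z i) (z k) ≤ 21 / 20} : ℝ)
          ≤ interactionEnergy lennardJones z := by
  rw [coerciveTwoShellGap_iff_allBadGap_and_tightContactGap,
    tightContactGap_iff_stableCore (θ := 71 / 100) (g := 1 / 100) (g' := 1 / 50) (by norm_num) (by norm_num)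
      (by norm_num) (by norm_num)]

/-- **Registered sub-goal `stub_stableCoreReduction` of the crux item** (skeleton `Lines/Sketch.lean`,
c4): the residual is equivalent to its instance on cores — `tightContactGap_iff_stableCore` in closed
form. [folklore] -/
theorem stub_stableCoreReduction :
    ∀ θ g g' : ℝ, 0 ≤ θ → θ < 711 / 1000 → 0 < g → 0 < g' →
    ((∀ δ : ℝ, 0 < δ → ∃ g₂ : ℝ, 0 < g₂ ∧ ∀ (N : ℕ) (x : Fin N → EuclideanSpace ℝ (Fin 3)),
      (∀ i j : Fin N, i ≠ j → δ ≤ dist (x i) (x j)) →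
      (N : ℝ) * (⨅ Q : PeriodicConfiguration 3, Q.energyPerParticle lennardJones)
        + g₂ * (Nat.card {j : Fin N // ¬ IsTwoShellGood (1 / 20) (47 / 50) 1 x j ∧
            ∃ i : Fin N, IsTwoShellGood (1 / 20) (47 / 50) 1 x i ∧ dist (x i) (x j) ≤ 21 / 20} : ℝ)
        ≤ interactionEnergy lennardJones x) ↔
    (∃ g₂ : ℝ, 0 < g₂ ∧ ∀ (K : ℕ) (z : Fin K → EuclideanSpace ℝ (Fin 3)),
      (∀ i j : Fin K, i ≠ j → (3 / 10 : ℝ) ≤ dist (z i) (z j)) →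
      (∀ j : Fin K, ∑ k ∈ Finset.univ.erase j,
        (min (lennardJones (dist (z j) (z k))) 0 +
          (1 / 2 : ℝ) * max (lennardJones (dist (z j) (z k))) 0) < -θ) →
      (∀ p : EuclideanSpace ℝ (Fin 3), (∀ i : Fin K, (3 / 10 : ℝ) ≤ dist p (z i)) →
        -(98309653 / 125000000 : ℝ) - g < ∑ i, lennardJones (dist p (z i))) →
      (∀ (j : Fin K) (p : EuclideanSpace ℝ (Fin 3)), (∀ k : Fin K, k ≠ j → (3 / 10 : ℝ) ≤ dist p (z k)) →
        ∑ k ∈ Finset.univ.erase j, lennardJones (dist (z j) (z k)) - g' <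
          ∑ k ∈ Finset.univ.erase j, lennardJones (dist p (z k))) →
      (K : ℝ) * (⨅ Q : PeriodicConfiguration 3, Q.energyPerParticle lennardJones)
        + g₂ * (Nat.card {k : Fin K // ¬ IsTwoShellGood (1 / 20) (47 / 50) 1 z k ∧
            ∃ i : Fin K, IsTwoShellGood (1 / 20) (47 / 50) 1 z i ∧ dist (z i) (z k) ≤ 21 / 20} : ℝ)
        ≤ interactionEnergy lennardJones z)) :=
  fun _ _ _ hθ0 hθ hg hg' => tightContactGap_iff_stableCore hθ0 hθ hg hg'

end Summit.AtomisticToContinuum.Crystallization.Theorems.PhononSlackCertificatesNearFarGlueR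

end
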